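import Summits.AtomisticToContinuum.Crystallization.Theorems.OverbindingBudgetUniformCutStatements
import Summits.AtomisticToContinuum.Crystallization.Theorems.OverbindingBudgetMuGSCLimit

/-!
# OverbindingBudget — the UNIFORM CUT, limit: the blow-down with varying spacing and the cones of node «UniformCut»
(helper, `--supports stmt-AtomisticToContinuum-31280`; decomp-a2c lens 4 «minimal counterexample / extremal reduction», generation 25; file 2
of 2 — the statements `MuCleanBallsU`, `GrossCleanBallsU`, `SoftCleanBallsU`, `CleanRegularityU`, `CleanLiouvilleU`, `SlackKissingRigidity`,
`BarlowStrainExclusion` are `…OverbindingBudgetUniformCutStatements`)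

## Contents (all proofs complete, 0 sorry)

* §D  two margin lemmas: the relaxed test under a change of spacing (`rt_of_spacing`: `|a − a'| ≤ η` costs margin `63/50·η`) and at the
  closed margin (`rt_of_rtAbove`: `RT a s` for all `s > T₀` gives `RT a T₀`, uniformly discrete textures).
* §E  the relaxed test on growing balls at CONVERGING spacings passes to two-way local limits (`rtAbove_of_limit_spacing`).
* §F  the blow-down with varying spacing, `regU_of_liouU : CleanLiouvilleU T₀ D → CleanRegularityU T₀ D` (`0 ≤ T₀`): the clean spacings
  `aₙ ∈ [47/50, 1]` of a failure sequence have a convergent subsequence (`IsCompact.tendsto_subseq`) BEFORE the matched subsequence is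
  extracted; the limit is globally `T₀`-clean at the limit spacing (§D–§E), a `μ`-ground state (`muGSCLimitClosed`, generation 24), with
  loosened thin cores at the fixed host spacing `b` (`thinCoresL_of_limit`) and `t`-robust violators `L`-densely at EVERY admissible spacing.
* §H  cones: `rdef_of_grossU_liouU_coherent : GrossCleanBallsU T₀ 10 → CleanLiouvilleU T₀ 10 → CleanlessExcessT → CoherentResidual 10 → RDEF`
  (`0 < T₀`) and `rdef_of_grossU_kissing_strain_coherent` (`0 < T₀ ≤ 1/10`); the instance of record `T₀ = 1/250`, `ρ = 1/5`
  (`rdef_of_uniformCut`): `RDEF ⟸ GrossCleanBallsU (1/250) 10 ∧ SlackKissingRigidity (1/250) (1/5) ∧ BarlowStrainExclusion (1/250) (1/5) 10 ∧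
  CleanlessExcessT ∧ CoherentResidual 10`.
-/

namespace Summit.AtomisticToContinuum.Crystallization.Theorems.OverbindingBudgetUniformCutLimit

open Filter Metric Set Topology
open scoped BigOperators
open Literature.MathematicalPhysics.StatisticalMechanics
open Summit.AtomisticToContinuum.Crystallization.Theses.OverbindingBudget (RobustDefectLimitWindows)
open Summit.AtomisticToContinuum.Crystallization.Theorems.OverbindingBudgetViolatorDensityFloor (GT RT)
open Summit.AtomisticToContinuum.Crystallization.Theorems.OverbindingBudgetWallTensionLever (ThinCores)
open Summit.AtomisticToContinuum.Crystallization.Theorems.OverbindingBudgetGradedBareness (CleanlessExcessT)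
open Summit.AtomisticToContinuum.Crystallization.Theorems.OverbindingBudgetCoherentCut (CoherentResidual)
open Summit.AtomisticToContinuum.Crystallization.Theorems.OverbindingBudgetMatchCompactness (exists_subseq_forall_eventually_match)
open Summit.AtomisticToContinuum.Crystallization.Theorems.OverbindingBudgetRecurrentSealStatements (sep_translate solid_translate
  translate_translate)
open Summit.AtomisticToContinuum.Crystallization.Theorems.OverbindingBudgetRecurrentSealClosure (solid_of_limit)
open Summit.AtomisticToContinuum.Crystallization.Theorems.OverbindingBudgetRecurrentDustStatements (ThinCoresL ViolatorsL window_finite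
  window_finite_lt rt_mono thinCoresL_of_thinCores thinCoresL_translate rt_translate)
open Summit.AtomisticToContinuum.Crystallization.Theorems.OverbindingBudgetRecurrentDustClosure (norm_le_of_dist_le rt_of_match
  thinCoresL_of_limit)
open Summit.AtomisticToContinuum.Crystallization.Theorems.OverbindingBudgetRegularityCutLimit (isMuGSC_translate violatorsL_of_limit_local)
open Summit.AtomisticToContinuum.Crystallization.Theorems.OverbindingBudgetMuGSCLimit (muGSCLimitClosed)
open Summit.AtomisticToContinuum.Crystallization.Theorems.OverbindingBudgetUniformCutStatements

/-! ## §D  Margin lemmas: change of spacing, the closed margin -/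

/-- **The relaxed test under a change of spacing**: `RT a s` at spacing `a` gives `RT a' (s + 63/50·η)` at any spacing `a'` with
`|a − a'| ≤ η` — each of the four thresholds `0.98a, 1.02a, 1.26a` moves by at most `63/50·η`. [folklore] -/
theorem rt_of_spacing {a a' η s : ℝ} {Y : Set (EuclideanSpace ℝ (Fin 3))} {y : EuclideanSpace ℝ (Fin 3)} (hY : UniformlyDiscrete Y)
    (haa : |a - a'| ≤ η) (h : RT a s Y y) : RT a' (s + 63 / 50 * η) Y y := by
  obtain ⟨hle1, hle2⟩ := abs_le.mp haa
  obtain ⟨h1, h2, h3⟩ := h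
  refine ⟨?_, ?_, fun w hw hwy => ?_⟩
  · refine le_trans (Set.ncard_le_ncard (fun w hw => ?_) (window_finite_lt hY y _)) h1
    exact ⟨hw.1, hw.2.1, by linarith [hw.2.2]⟩
  · refine h2.trans (Set.ncard_le_ncard (fun w hw => ?_) (window_finite hY y _))
    exact ⟨hw.1, hw.2.1, by linarith [hw.2.2]⟩
  · obtain ⟨hlo, hdich⟩ := h3 w hw hwy
    exact ⟨by linarith, hdich.imp (fun h => by linarith) (fun h => by linarith)⟩

/-- **The relaxed test at the closed margin**: in a uniformly discrete texture, `RT a s` for every `s > T₀` gives `RT a T₀` (the windows are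
finite, so each strict inequality family stabilises just above `T₀`).  Converse: `rt_mono`. [folklore] -/
theorem rt_of_rtAbove {a T₀ : ℝ} {Y : Set (EuclideanSpace ℝ (Fin 3))} {y : EuclideanSpace ℝ (Fin 3)} (hY : UniformlyDiscrete Y)
    (h : ∀ s : ℝ, T₀ < s → RT a s Y y) : RT a T₀ Y y := by
  classical
  refine ⟨?_, ?_, fun w hw hwy => ?_⟩
  · -- the open `1.26a`-window
    set W : Set (EuclideanSpace ℝ (Fin 3)) := {w ∈ Y | w ≠ y ∧ dist y w < a * (63 / 50) - T₀} with hW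
    have hWfin : W.Finite := window_finite_lt hY y _
    by_cases hWne : W.Nonempty
    · obtain ⟨w₀, hw₀, hmax⟩ := Set.exists_max_image W (fun w => dist y w) hWfin hWne
      have hlt : dist y w₀ < a * (63 / 50) - T₀ := hw₀.2.2
      have hsT : T₀ < T₀ + (a * (63 / 50) - T₀ - dist y w₀) / 2 := by linarith
      refine le_trans (Set.ncard_le_ncard (fun w hw => ?_) (window_finite_lt hY y _)) (h _ hsT).1
      have := hmax w hw
      exact ⟨hw.1, hw.2.1, by linarith⟩
    · rw [Set.not_nonempty_iff_eq_empty] at hWne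
      rw [hWne, Set.ncard_empty]
      norm_num
  · -- the closed `1.02a`-window
    set V : Set (EuclideanSpace ℝ (Fin 3)) :=
      {w ∈ Y | w ≠ y ∧ dist y w ≤ a * (1 + 1 / 50) + (T₀ + 1) ∧ a * (1 + 1 / 50) + T₀ < dist y w} with hV
    have hVfin : V.Finite :=
      (window_finite hY y (a * (1 + 1 / 50) + (T₀ + 1))).subset fun w hw => ⟨hw.1, hw.2.1, hw.2.2.1⟩
    obtain ⟨s, hsT, hs1, hsV⟩ : ∃ s : ℝ, T₀ < s ∧ s ≤ T₀ + 1 ∧ ∀ w ∈ V, a * (1 + 1 / 50) + s < dist y w := by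
      by_cases hVne : V.Nonempty
      · obtain ⟨w₀, hw₀, hmin⟩ := Set.exists_min_image V (fun w => dist y w) hVfin hVne
        have hgt : a * (1 + 1 / 50) + T₀ < dist y w₀ := hw₀.2.2.2
        have hle : dist y w₀ ≤ a * (1 + 1 / 50) + (T₀ + 1) := hw₀.2.2.1
        refine ⟨T₀ + (dist y w₀ - a * (1 + 1 / 50) - T₀) / 2, by linarith, by linarith, fun w hw => ?_⟩
        have := hmin w hw
        linarith
      · rw [Set.not_nonempty_iff_eq_empty] at hVne
        refine ⟨T₀ + 1, by linarith, le_rfl, fun w hw => ?_⟩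
        rw [hVne] at hw
        exact absurd hw (Set.notMem_empty _)
    refine (h s hsT).2.1.trans (Set.ncard_le_ncard (fun w hw => ?_) (window_finite hY y _))
    refine ⟨hw.1, hw.2.1, ?_⟩
    by_contra hgt
    push Not at hgt
    have hwV : w ∈ V := ⟨hw.1, hw.2.1, by linarith [hw.2.2], hgt⟩
    linarith [hsV w hwV, hw.2.2]
  · -- the bands
    constructor
    · refine le_of_forall_pos_lt_add fun τ hτ => ?_
      have := ((h (T₀ + τ / 2) (by linarith)).2.2 w hw hwy).1
      linarith
    · by_cases hle : dist y w ≤ a * (1 + 1 / 50) + T₀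
      · exact Or.inl hle
      · right
        push Not at hle
        refine le_of_forall_pos_lt_add fun τ hτ => ?_
        have hm1 : min (τ / 2) ((dist y w - a * (1 + 1 / 50) - T₀) / 2) ≤ τ / 2 := min_le_left _ _
        have hm2 : min (τ / 2) ((dist y w - a * (1 + 1 / 50) - T₀) / 2) ≤ (dist y w - a * (1 + 1 / 50) - T₀) / 2 := min_le_right _ _
        have hm0 : 0 < min (τ / 2) ((dist y w - a * (1 + 1 / 50) - T₀) / 2) := lt_min (by linarith) (by linarith)
        obtain ⟨-, hdich⟩ := (h (T₀ + min (τ / 2) ((dist y w - a * (1 + 1 / 50) - T₀) / 2)) (by linarith)).2.2 w hw hwy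
        rcases hdich with h1 | h1
        · exfalso; linarith
        · linarith

/-! ## §E  Local limit closure: cleanness on growing balls at converging spacings -/

/-- **The relaxed test on growing balls at CONVERGING spacings passes to local limits at every margin above**: if every site of `Zs k`
within `ρ k → ∞` of `0` passes `RT (aseq k) T₀`, `aseq k → alim ∈ [47/50, 1]`, then every site of a two-way local limit `Z` passes `RT alim s` for
every `s > T₀` (move the spacing, `rt_of_spacing`, margin loss `63/50·|aseq k − alim| → 0`; cross the matching, `rt_of_match`, loss `3ε → 0`).
[folklore] -/
theorem rtAbove_of_limit_spacing {δ T₀ alim : ℝ} (hδ : 0 < δ) (ha : 47 / 50 ≤ alim) (ha1 : alim ≤ 1) (hT₀ : 0 ≤ T₀)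
    {Zs : ℕ → Set (EuclideanSpace ℝ (Fin 3))} {Z : Set (EuclideanSpace ℝ (Fin 3))} (hsepk : ∀ k, ∀ p ∈ Zs k, ∀ q ∈ Zs k, p ≠ q → δ ≤ dist p q)
    (hsep : ∀ p ∈ Z, ∀ q ∈ Z, p ≠ q → δ ≤ dist p q)
    (hconv : ∀ R ε : ℝ, 0 < ε → ∀ᶠ k in atTop, Match ε R 0 (Zs k) Z)
    {ρ : ℕ → ℝ} (hρ : Tendsto ρ atTop atTop) {aseq : ℕ → ℝ} (has : Tendsto aseq atTop (𝓝 alim))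
    (hclean : ∀ k, ∀ y ∈ Zs k, ‖y‖ ≤ ρ k → RT (aseq k) T₀ (Zs k) y) :
    ∀ y' ∈ Z, ∀ s : ℝ, T₀ < s → RT alim s Z y' := by
  intro y' hy' s hs
  have ha0 : 0 < alim := by linarith
  obtain ⟨ε, hε0, hε3, hεδ, hε2⟩ : ∃ ε : ℝ, 0 < ε ∧ 3 * ε ≤ (s - T₀) / 2 ∧ 2 * ε < δ ∧ ε ≤ 1 / 2 :=
    ⟨min ((s - T₀) / 6) (min (δ / 4) (1 / 2)), by positivity,
      by have := min_le_left ((s - T₀) / 6) (min (δ / 4) (1 / 2)); linarith,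
      by have := (min_le_right ((s - T₀) / 6) (min (δ / 4) (1 / 2))).trans (min_le_left _ _); linarith,
      by have := (min_le_right ((s - T₀) / 6) (min (δ / 4) (1 / 2))).trans (min_le_right _ _); linarith⟩
  set η : ℝ := (s - T₀) / 3 with hη
  have hη0 : 0 < η := by rw [hη]; linarith
  set R₀ : ℝ := ‖y'‖ + |T₀| + |s| + 6 with hR₀
  have hak : ∀ᶠ k in atTop, dist (aseq k) alim < η := Metric.tendsto_nhds.1 has η hη0
  obtain ⟨k, hk, hkρ, hka⟩ := ((hconv R₀ ε hε0).and ((hρ.eventually_ge_atTop (‖y'‖ + 1)).and hak)).exists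
  obtain ⟨y, hy, hyd⟩ := hk.1 y' hy' (by rw [dist_zero_right]; linarith [abs_nonneg T₀, abs_nonneg s])
  have hyn : ‖y‖ ≤ ‖y'‖ + ε := norm_le_of_dist_le hyd
  have hRT : RT (aseq k) T₀ (Zs k) y := hclean k y hy (by linarith)
  have haa : |aseq k - alim| ≤ η := by rw [← Real.dist_eq]; exact hka.le
  have hRT' : RT alim (T₀ + 63 / 50 * η) (Zs k) y := rt_of_spacing ⟨δ, hδ, hsepk k⟩ haa hRT
  have hs0 : 0 ≤ T₀ + 63 / 50 * η := by positivity
  have hR1 : ‖y‖ + (T₀ + 63 / 50 * η) + 4 ≤ R₀ := by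
    rw [hR₀, hη]; linarith [le_abs_self T₀, le_abs_self s]
  have h' := rt_of_match (hsepk k) hsep hε0.le hεδ hε2 hk ha0 ha1 hs0 hy hy' hyd hR1 hRT'
  exact rt_mono ⟨δ, hδ, hsep⟩ (by rw [hη]; linarith) h'

/-! ## §F  The blow-down with varying spacing -/

/-- **The blow-down, spacing-uniformly.**  `CleanLiouvilleU T₀ D → CleanRegularityU T₀ D` (`0 ≤ T₀`): a failure of uniform ε-regularity
along radii `R = n → ∞` at data `(e, δ, b, t, L)` comes with clean spacings `aₙ ∈ [47/50, 1]`; pass to a subsequence along which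
`aₙ → alim` (`IsCompact.tendsto_subseq`), re-root at the centres of the clean balls, extract a two-way locally matched subsequence and limit
`Z` (`exists_subseq_forall_eventually_match`), and pass everything to the limit: covering, the `μ`-ground-state property
(`muGSCLimitClosed`), loosened thin cores at the FIXED host spacing `b` (`thinCoresL_of_limit`), global `T₀`-cleanness at `alim`
(`rtAbove_of_limit_spacing` + `rt_of_rtAbove`), and `t`-robust violators `L`-densely at EVERY admissible spacing
(`violatorsL_of_limit_local`, spacing by spacing).  The Liouville statement makes `Z` globally `t/2`-clean at some admissible `a'`, where
`Z` has a `t`-robust violator: contradiction. [this file] -/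
theorem regU_of_liouU {T₀ D : ℝ} (hT₀ : 0 ≤ T₀) (hL : CleanLiouvilleU T₀ D) : CleanRegularityU T₀ D := by
  classical
  intro e hT hlb δ hδ b hb1 hb2 t ht ht1 L
  by_contra hno
  push Not at hno
  choose Y hsepY hcovY hμY hthinY a ha1 ha2 q hq hcleanY hviolY using fun n : ℕ => hno (n : ℝ)
  -- re-root at the centres of the clean balls
  set Zs : ℕ → Set (EuclideanSpace ℝ (Fin 3)) := fun n => (fun p => p - q n) '' Y n with hZs
  have hsepk : ∀ n, ∀ p ∈ Zs n, ∀ p' ∈ Zs n, p ≠ p' → δ ≤ dist p p' := fun n => sep_translate (q n) (hsepY n)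
  have hsolidk : ∀ n, ∀ z : EuclideanSpace ℝ (Fin 3), ∃ w ∈ Zs n, dist z w ≤ 9 / 10 := fun n =>
    solid_translate (q n) fun z =>
      let ⟨w, hw, hd⟩ := hcovY n z
      ⟨w, hw, hd.le⟩
  have hμk : ∀ n, IsMuGSC lennardJones e (Zs n) := fun n => isMuGSC_translate ⟨δ, hδ, hsepY n⟩ (hμY n) (q n)
  have hthink : ∀ n, ThinCoresL b D (Zs n) := fun n => thinCoresL_translate (q n) (thinCoresL_of_thinCores hb1 (hthinY n))
  have hcleank : ∀ n, ∀ y ∈ Zs n, ‖y‖ ≤ (n : ℝ) → RT (a n) T₀ (Zs n) y := by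
    rintro n _ ⟨p, hp, rfl⟩ hn
    have hd : dist p (q n) ≤ n := by rwa [dist_eq_norm]
    exact rt_translate (q n) (hcleanY n p hp hd)
  have hviolk : ∀ n, ∀ a' : ℝ, 47 / 50 ≤ a' → a' ≤ 1 → ∀ q' ∈ Zs n, ‖q'‖ ≤ (n : ℝ) →
      ∃ y ∈ Zs n, dist y q' ≤ L ∧ ∀ s : ℝ, 0 < s → s < t → ¬ RT a' s (Zs n) y := by
    rintro n a' ha1' ha2' _ ⟨p', hp', rfl⟩ hn
    have hd : dist p' (q n) ≤ n := by rwa [dist_eq_norm]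
    obtain ⟨y, hy, hyd, hyn⟩ := hviolY n a' ha1' ha2' p' hp' hd
    refine ⟨y - q n, ⟨y, hy, rfl⟩, by rwa [dist_sub_right], fun s hs hst hRT => hyn ?_⟩
    have h1 := rt_translate (-q n) hRT
    rw [translate_translate, sub_neg_eq_add, sub_add_cancel] at h1
    exact rt_mono ⟨δ, hδ, hsepY n⟩ hst.le h1
  -- a subsequence along which the clean spacings converge
  obtain ⟨alim, halim, φ₁, hφ₁, hlim₁⟩ :=
    (isCompact_Icc : IsCompact (Set.Icc (47 / 50 : ℝ) 1)).tendsto_subseq (x := a) fun n => ⟨ha1 n, ha2 n⟩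
  obtain ⟨hal1, hal2⟩ := halim
  -- a two-way locally matched subsequence and its limit
  obtain ⟨φ₂, Z, hφ₂, hZsep, hconv⟩ := exists_subseq_forall_eventually_match hδ (fun k => Zs (φ₁ k)) fun k => hsepk (φ₁ k)
  have hconv' : ∀ R ε : ℝ, 0 < ε → ∀ᶠ k in atTop, Match ε R 0 (Zs (φ₁ (φ₂ k))) Z := hconv
  have hψ : StrictMono (fun k => φ₁ (φ₂ k)) := hφ₁.comp hφ₂
  have hρ : Tendsto (fun k : ℕ => ((φ₁ (φ₂ k) : ℕ) : ℝ)) atTop atTop := tendsto_natCast_atTop_atTop.comp hψ.tendsto_atTop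
  have has : Tendsto (fun k => a (φ₁ (φ₂ k))) atTop (𝓝 alim) := hlim₁.comp hφ₂.tendsto_atTop
  have hZsolid : ∀ z : EuclideanSpace ℝ (Fin 3), ∃ w ∈ Z, dist z w ≤ 9 / 10 :=
    solid_of_limit hδ hZsep hconv' fun k => hsolidk (φ₁ (φ₂ k))
  have hZμ : IsMuGSC lennardJones e Z :=
    muGSCLimitClosed e δ hδ (fun k => Zs (φ₁ (φ₂ k))) Z (fun k => hsepk (φ₁ (φ₂ k))) (fun k => hμk (φ₁ (φ₂ k))) hZsep hconv'
  have hZthin : ThinCoresL b D Z :=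
    thinCoresL_of_limit hδ hb1 hb2 (fun k => hsepk (φ₁ (φ₂ k))) hZsep hconv' fun k => hthink (φ₁ (φ₂ k))
  have hZclean : ∀ y' ∈ Z, ∀ s : ℝ, T₀ < s → RT alim s Z y' :=
    rtAbove_of_limit_spacing hδ hal1 hal2 hT₀ (fun k => hsepk (φ₁ (φ₂ k))) hZsep hconv' hρ has fun k => hcleank (φ₁ (φ₂ k))
  have hZviol : ∀ a' : ℝ, 47 / 50 ≤ a' → a' ≤ 1 → ViolatorsL a' t L Z := fun a' ha1' ha2' =>
    violatorsL_of_limit_local hδ ha1' ha2' (fun k => hsepk (φ₁ (φ₂ k))) hZsep hconv' hρ fun k => hviolk (φ₁ (φ₂ k)) a' ha1' ha2'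
  -- the Liouville statement forbids the limit's violators
  obtain ⟨a', ha1', ha2', hall⟩ := hL e hT hlb Z ⟨δ, hδ, hZsep⟩ hZsolid hZμ b hb1 hb2 hZthin alim hal1 hal2
    (fun y hy => rt_of_rtAbove ⟨δ, hδ, hZsep⟩ (hZclean y hy)) (t / 2) (by linarith)
  obtain ⟨w, hw, -⟩ := hZsolid 0
  obtain ⟨y, hy, -, hn⟩ := hZviol a' ha1' ha2' w hw
  exact hn (t / 2) (by linarith) (by linarith) (hall y hy)

/-- **The uniform cut, blown down.**  `GrossCleanBallsU T₀ D → CleanLiouvilleU T₀ D → MuCleanBallsU D` (`0 < T₀`). [this file] -/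
theorem mcbU_of_grossU_liouU {T₀ D : ℝ} (hT : 0 < T₀) (hG : GrossCleanBallsU T₀ D) (hL : CleanLiouvilleU T₀ D) : MuCleanBallsU D :=
  mcbU_of_grossU_softU hG (softU_of_regU (regU_of_liouU hT.le hL))

/-! ## §H  The cones -/

/-- **The cone of the node (two laws).**  `GrossCleanBallsU T₀ 10 → CleanLiouvilleU T₀ 10 → CleanlessExcessT → CoherentResidual 10 →
RobustDefectLimitWindows` for `T₀ > 0`. [this file] -/
theorem rdef_of_grossU_liouU_coherent {T₀ : ℝ} (hT : 0 < T₀) (hG : GrossCleanBallsU T₀ 10) (hL : CleanLiouvilleU T₀ 10)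
    (hCE : CleanlessExcessT) (hR : CoherentResidual 10) : RobustDefectLimitWindows :=
  rdef_of_mcbU_coherent (mcbU_of_grossU_liouU hT hG hL) hCE hR

/-- **The cone of the node (three laws).**  `GrossCleanBallsU T₀ 10 → SlackKissingRigidity T₀ ρ → BarlowStrainExclusion T₀ ρ 10 →
CleanlessExcessT → CoherentResidual 10 → RobustDefectLimitWindows` for `0 < T₀ ≤ 1/10`. [this file] -/
theorem rdef_of_grossU_kissing_strain_coherent {T₀ ρ : ℝ} (hT : 0 < T₀) (hT1 : T₀ ≤ 1 / 10) (hG : GrossCleanBallsU T₀ 10)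
    (hK : SlackKissingRigidity T₀ ρ) (hS : BarlowStrainExclusion T₀ ρ 10) (hCE : CleanlessExcessT) (hR : CoherentResidual 10) :
    RobustDefectLimitWindows :=
  rdef_of_grossU_liouU_coherent hT hG (liouU_of_kissing_strain hT1 hK hS) hCE hR

/-- **The instance of record** (`T₀ = 1/250`, `ρ = 1/5`): `GrossCleanBallsU (1/250) 10 → SlackKissingRigidity (1/250) (1/5) →
BarlowStrainExclusion (1/250) (1/5) 10 → CleanlessExcessT → CoherentResidual 10 → RobustDefectLimitWindows`. [this file] -/
theorem rdef_of_uniformCut (hG : GrossCleanBallsU (1 / 250) 10) (hK : SlackKissingRigidity (1 / 250) (1 / 5))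
    (hS : BarlowStrainExclusion (1 / 250) (1 / 5) 10) (hCE : CleanlessExcessT) (hR : CoherentResidual 10) : RobustDefectLimitWindows :=
  rdef_of_grossU_kissing_strain_coherent (by norm_num) (by norm_num) hG hK hS hCE hR

end Summit.AtomisticToContinuum.Crystallization.Theorems.OverbindingBudgetUniformCutLimit
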